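import Mathlib
import Summits.AtomisticToContinuum.HydrodynamicLimit.Theorems.ImplosionDichotomyDenseExcursionSonicSlavingContour
import Summits.AtomisticToContinuum.HydrodynamicLimit.Theorems.ImplosionDichotomyDenseExcursionSonicCavityDefsD

/-!
# Stub `stub_sonicSlaving` of the line `sonic-cavity-renewal` (skeleton v8, crux `DenseExcursion`, stmt-AtomisticToContinuum-12586)

Proof file (`--supports stmt-AtomisticToContinuum-12586`, lead a2). SONIC SLAVING from the certified wedge-and-loop data: the
three-line bridge from `CavityTubeWedgeLoop r W S` (…SonicCavityDefsD: holomorphic continuation of the pinned profile to `sonicWedge`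
with traces and the two speed bounds, plus the loop clause `CavityTubeLoop`) to the landed closed-contour theorem
`sonicSlaving_of_wedgeLoop` (…SonicSlavingContour, p161760; wave-3 worker A of the lead's seat: Literature
`HolomorphicLinearODEStarConvex`, `LoopSlavingEstimate`, `SmoothstepPolygon`; wedge continuation of smooth radial modes; the twelve-edge
contour; conjugation symmetry; `Re Λ ≤ 3`). Mathematics: the slaved gauge `G = e^{−Θ}(P − ρM)` of a smooth radial mode, continued
holomorphically, is transported once around a closed loop through `x_m = −7/10` and around the sonic point; single-valuedness closes the
loop, the first leg gains `e^{−151}`, and the loop estimate gives `|Im Λ|·‖D(x_m)‖ ≤ (1/90)‖m(x_m)‖ ≤ 2‖m(x_m)‖` for `|Im Λ| > boxTop`.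
Sources: Chen–Shkoller–Vicol arXiv:2605.00808 §1.10; Coddington–Levinson 1955 Ch. 3 §7; worker report `A_sonicSlaving.REPORT.md`.
-/

noncomputable section

namespace Summit.AtomisticToContinuum.HydrodynamicLimit.Theorems.SonicCavityRenewal

open Summit.AtomisticToContinuum.HydrodynamicLimit.Theorems.R2OneModeTwoConditions

/-- **Stub `stub_sonicSlaving` (skeleton v8 of line `sonic-cavity-renewal`): SONIC SLAVING.** For a pinned-window monatomic profile with
its cavity tube and the certified wedge-and-loop data, every smooth radial mode with `−1/4 < Re Λ ≤ boxSide` and `|Im Λ| > boxTop` has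
its p-wave content at the matching point slaved: `|Im Λ|·‖D‖ ≤ 2‖m(x_m)‖` (`SonicSlaving r W S`). Three-line bridge to
`sonicSlaving_of_wedgeLoop`. [cite: ChenShkollerVicol2026, §1.10] -/
theorem stub_sonicSlaving : ∀ (r : ℝ) (W S : ℝ → ℝ), (17307 / 15625 : ℝ) ≤ r → r ≤ 697 / 625 → IsMonatomicProfile r W S → OrigProfileEqs r W S → CavityTube r W S → CavityTubeWedgeLoop r W S → SonicSlaving r W S := by
  intro r W S hr1 hr2 hP _ hT h
  obtain ⟨Wc, Sc, h1, h2, h3, -, h5, h6, -, hL, hV, hG⟩ := h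
  exact sonicSlaving_of_wedgeLoop r W S Wc Sc _ hr1 hr2 hP hT h1 h2 h3 h5 h6 rfl hL hV (hG _ rfl)

end Summit.AtomisticToContinuum.HydrodynamicLimit.Theorems.SonicCavityRenewal

end
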